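import Literature.AlgebraicGeometry.HodgeTheory.AlgebraicityLocusCurves
import Literature.AlgebraicGeometry.HodgeTheory.AlgebraicityLocusParametrised
import Literature.AlgebraicGeometry.Motives.CurveThroughTwoPoints
import Literature.AlgebraicGeometry.Motives.AbelianVarietyProofs
import Literature.AlgebraicGeometry.Motives.VarietiesGeometricallyIntegralProofs
import HarnessLib

/-!
# Algebraicity at the boundary of a good parameter variety (Charles–Schnell 2014, Prop. 11.3.11)

Topic `Literature/AlgebraicGeometry/HodgeTheory` (family `hodge`), fourth proof file towards the
named fact `charlesSchnell_algebraicityLocus_iUnion_closed` (`AlgebraicityLocus.lean`), after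
`AlgebraicityLocusParametrised` (glue), `SupportedLocusClosed` (strong closedness of the good sets,
Zariski-closure upgrade) and `AlgebraicityLocusCurves` (limits of supported classes along a smooth
curve, `mem_algebraicClasses_of_curve`).

In the printed proof (Charles–Schnell, *Notes on absolute Hodge classes*, proof of Prop. 11.3.11;
Voisin, *Hodge Theory II*, §3.3.1 and proof of Thm. 7.19) the closure of the image of a component
of the relative Hilbert scheme still parametrises algebraic classes because limits of algebraic
cycles are algebraic cycles; the limit is taken along a curve through the boundary point. This file
performs that step on the tree's carriers, GRANTED Mumford's lemma that two points of an
irreducible variety lie on an irreducible curve, which is the tree's (unproved) named fact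
`Motives.mumford_smoothCurve_through_two_points` (`Motives/CurveThroughTwoPoints.lean`), taken here
as an explicit hypothesis `hM`:

* `mem_algebraicClasses_of_mem_irreducible` — for `f : 𝒳 ⟶ S` a smooth projective family over a
  smooth quasi-projective base, a parameter `ℂ`-scheme `h : H ⟶ S` locally of finite type with a
  Zariski-closed family of supports `𝒵 ⊆ 𝒳 × H`, a class `A ∈ H²ᵖ(𝒳(ℂ); ℂ)`, and `Y ⊆ H` closed
  irreducible meeting an open `U` over which the slices of `𝒵` have codimension `≥ p` and `A` dies
  off them: `A|_{𝒳_{h(y₁)}} ∈ algebraicClasses (𝒳_{h(y₁)}) p` at EVERY complex point `y₁` over `Y`.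
  Proof: restrict to an affine open chart `V ∋ pt y₁` (`Scheme.affineCover`), pick a complex point
  of `V` over `U ∩ Y` (Jacobson), join the two by the smooth integral affine curve `g : C → V`
  inside `Y` of Mumford's lemma, pull the family back to `𝒳 × C` and apply
  `mem_algebraicClasses_of_curve`.

Supporting lemmas (proved): the output of Mumford's lemma is a smooth integral curve in the sense
of the tree (`isIntegral_and_smoothOfRelativeDimension_one`: smooth over `ℂ` implies reduced,
`Motives.isReduced_of_smooth_over_field`; the relative dimension of a smooth irreducible scheme
exists, `Motives.exists_smoothOfRelativeDimension_of_smooth`, and equals its dimension,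
`Motives.topologicalKrullDim_eq_of_smoothOfRelativeDimension`); slices commute with base change
of parameters (`sliceAt_whiskerLeft`); non-empty locally closed subsets carry complex points
(`exists_complexPoint_pt_mem_inter`).

## References

* [CharlesSchnell2014Notes] F. Charles, C. Schnell, Notes on absolute Hodge classes, in Hodge
  Theory (Princeton Math. Notes 49, 2014), Prop. 11.3.11 (proof).
* [VoisinHodgeII2003] C. Voisin, Hodge Theory and Complex Algebraic Geometry II (2003), §3.3.1,
  §7.3.2 (proof of Thm. 7.19).
* [MumfordAV1970] D. Mumford, Abelian Varieties (1970), §6, Lemma.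
* [GortzWedhorn2020] U. Görtz, T. Wedhorn, Algebraic Geometry I, 2nd ed. (2020), Lemma 6.26,
  Cor. 6.32.
-/

noncomputable section

open CategoryTheory AlgebraicGeometry Limits Set Order MonoidalCategory CartesianMonoidalCategory
open _root_.Topology
open Literature.AlgebraicGeometry.Motives

universe u

namespace Literature.AlgebraicGeometry.HodgeTheory

section HodgeTheory

/-! ### Smooth irreducible affine curves are integral of relative dimension one -/

/-- **The curve of Mumford's lemma is a smooth integral curve in the sense of the tree**: a
`ℂ`-scheme which is irreducible, smooth over `ℂ` and of topological Krull dimension `1` (the output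
of `Motives.mumford_smoothCurve_through_two_points`) is integral (smooth over a field implies
reduced, `Motives.isReduced_of_smooth_over_field`) and smooth of relative dimension `1` (a smooth
morphism with irreducible source has a relative dimension,
`Motives.exists_smoothOfRelativeDimension_of_smooth`, equal to the dimension,
`Motives.topologicalKrullDim_eq_of_smoothOfRelativeDimension`).
[cite: GortzWedhorn2020, Lemma 6.26 and Cor. 6.32] -/
theorem isIntegral_and_smoothOfRelativeDimension_one (C : Motives.SchemeOver ℂ)
    [IrreducibleSpace C.left] [Smooth C.hom] (hdim : topologicalKrullDim C.left = 1) :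
    IsIntegral C.left ∧ SmoothOfRelativeDimension 1 C.hom := by
  haveI : IsReduced C.left := isReduced_of_smooth_over_field C.hom
  refine ⟨isIntegral_of_irreducibleSpace_of_isReduced _, ?_⟩
  obtain ⟨m, hm⟩ := exists_smoothOfRelativeDimension_of_smooth C.hom
  haveI := hm
  have h := topologicalKrullDim_eq_of_smoothOfRelativeDimension C.hom (n := m)
  rw [hdim] at h
  have hm1 : m = 1 := by exact_mod_cast h.symm
  subst hm1
  exact hm

/-! ### Slices and base change of the parameter scheme -/

/-- Slices commute with base change of the parameter scheme: `i_y ≫ (𝒳 × g) = i_{g(y)}`.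
[folklore] -/
theorem sliceAt_whiskerLeft {X H H' : Motives.SchemeOver ℂ} (g : H' ⟶ H)
    (y : Motives.ComplexPoints H') : sliceAt X y ≫ X ◁ g = sliceAt X (AlgPoints.map g y) := by
  simp only [sliceAt, CartesianMonoidalCategory.lift_whiskerLeft, Category.assoc,
    AlgPoints.map_apply]

/-- `sliceAt_whiskerLeft` on points. [folklore] -/
theorem whiskerLeft_sliceAt_base_apply {X H H' : Motives.SchemeOver ℂ} (g : H' ⟶ H)
    (y : Motives.ComplexPoints H') (x : X.left) :
    (X ◁ g).left.base ((sliceAt X y).left.base x) =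
      (sliceAt X (AlgPoints.map g y)).left.base x := by
  rw [← sliceAt_whiskerLeft g y]
  rfl

/-! ### Complex points in non-empty locally closed subsets -/

/-- A non-empty intersection of an open and a closed subset of a `ℂ`-scheme locally of finite type
contains the point of a complex point (`ℂ`-schemes locally of finite type are Jacobson, and closed
points are complex points, `Motives.ComplexPoints.equivClosedPoints`). [folklore] -/
theorem exists_complexPoint_pt_mem_inter {H : Motives.SchemeOver ℂ} [LocallyOfFiniteType H.hom]
    {U Y : Set H.left} (hUo : IsOpen U) (hYc : IsClosed Y) (hUY : (U ∩ Y).Nonempty) :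
    ∃ y : Motives.ComplexPoints H, y.pt ∈ U ∩ Y := by
  haveI : JacobsonSpace H.left := LocallyOfFiniteType.jacobsonSpace H.hom
  obtain ⟨x, hx, hxc⟩ :=
    nonempty_inter_closedPoints hUY (hUo.isLocallyClosed.inter hYc.isLocallyClosed)
  set u := (Motives.ComplexPoints.equivClosedPoints H).symm ⟨x, hxc⟩ with hu
  have hupt : u.pt = x := by
    have h := Motives.ComplexPoints.coe_equivClosedPoints_apply H u
    rw [hu, Equiv.apply_symm_apply] at h
    exact h.symm
  exact ⟨u, hupt ▸ hx⟩

/-! ### The boundary step: algebraicity at all complex points of an irreducible parameter variety -/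

variable {𝒳 S : Motives.SchemeOver ℂ} (f : 𝒳 ⟶ S)

/-- **Algebraicity at the boundary points of a good irreducible parameter variety**
(Charles–Schnell, proof of Prop. 11.3.11, the step "the closure of the image of a component of
the Hilbert scheme still parametrises algebraic classes", in the tree's support language and
granted Mumford's lemma on curves through two points). Let `f : 𝒳 ⟶ S` be a smooth projective
family of relative dimension `n` over a smooth quasi-projective base, `h : H ⟶ S` a parameter
`ℂ`-scheme locally of finite type carrying a Zariski-closed family of supports `𝒵 ⊆ 𝒳 × H`,
`A ∈ H²ᵖ(𝒳(ℂ); ℂ)`, and `Y ⊆ H` closed irreducible meeting an open `U ⊆ H` such that at every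
complex point `y` over `U ∩ Y` the slice `𝒵_y ⊆ 𝒳_{h(y)}` has codimension `≥ p` and
`A|_{𝒳_{h(y)}}` dies off `𝒵_y`. Then `A|_{𝒳_{h(y₁)}}` is algebraic at EVERY complex point `y₁`
over `Y`. Proof: for `pt y₁ ∈ U` this is the definition of `algebraicClasses`; otherwise choose an
affine open chart `V ∋ pt y₁` of `H`, a complex point `y₂` of `V` over `U ∩ Y` (Jacobson), and —
Mumford's lemma in `V` for the irreducible closed `V ∩ Y` — a smooth integral affine curve
`g : C → V` inside `Y` through `y₁`, `y₂`; pull the family back to `𝒳 × C` and apply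
`mem_algebraicClasses_of_curve` (limits of supported classes along a curve).
[cite: CharlesSchnell2014Notes, Prop. 11.3.11 (proof)]
[cite: VoisinHodgeII2003, §3.3.1 and §7.3.2] [cite: MumfordAV1970, §6, Lemma] -/
theorem mem_algebraicClasses_of_mem_irreducible
    (hM : Motives.mumford_smoothCurve_through_two_points) {n : ℕ}
    (hfam : Motives.IsSmoothProjectiveFamily f n) (hS : IsQuasiProjectiveOver S)
    (hSsm : Smooth S.hom) {H : Motives.SchemeOver ℂ} [LocallyOfFiniteType H.hom] (h : H ⟶ S)
    {𝒵 : Set (𝒳 ⊗ H).left} (h𝒵 : IsClosed 𝒵) (p : ℕ) (A : complexBetti 𝒳 (2 * p))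
    {Y U : Set H.left} (hYc : IsClosed Y) (hY : IsIrreducible Y) (hUo : IsOpen U)
    (hUY : (U ∩ Y).Nonempty)
    (hcodim : ∀ y : Motives.ComplexPoints H, y.pt ∈ U ∩ Y → ∀ x : 𝒳.left,
      (sliceAt 𝒳 y).left.base x ∈ 𝒵 → height x + p ≤ (n : ℕ∞))
    (hgood : ∀ y : Motives.ComplexPoints H, y.pt ∈ U ∩ Y →
      complexBetti.map (Motives.fiberι f (AlgPoints.map h y)) (2 * p) A ∈
        LinearMap.ker (complexBetti.restrictCompl (Motives.fiberOver f (AlgPoints.map h y))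
          ((lift (Motives.fiberι f (AlgPoints.map h y))
            (Motives.fiberOverToSpec f (AlgPoints.map h y) ≫ y)).left.base ⁻¹' 𝒵) (2 * p)).hom)
    (y₁ : Motives.ComplexPoints H) (hy₁ : y₁.pt ∈ Y) :
    complexBetti.map (Motives.fiberι f (AlgPoints.map h y₁)) (2 * p) A ∈
      algebraicClasses (Motives.fiberOver f (AlgPoints.map h y₁)) p := by
  haveI : Smooth S.hom := hSsm
  by_cases hy₁U : y₁.pt ∈ U
  · -- over `U` the slice of `𝒵` itself is a witness
    refine mem_supportedClasses_of_restrictCompl_eq_zero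
      (h𝒵.preimage (lift (Motives.fiberι f (AlgPoints.map h y₁))
        (Motives.fiberOverToSpec f (AlgPoints.map h y₁) ≫ y₁)).left.continuous) ?_
      (LinearMap.mem_ker.1 (hgood y₁ ⟨hy₁U, hy₁⟩))
    intro z hz
    rw [le_coheight_iff_height_add_le (hfam.isSmoothProjective (AlgPoints.map h y₁)) z p,
      ← height_fiberι_base_eq f (AlgPoints.map h y₁) z]
    rw [Set.mem_preimage, lift_fiberι_base_apply] at hz
    exact hcodim y₁ ⟨hy₁U, hy₁⟩ _ hz
  -- an affine open `V ∋ pt y₁` of `H`, as a `ℂ`-scheme `V'` with `ι' : V' ⟶ H`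
  obtain ⟨i, v, hv⟩ := H.left.affineCover.exists_eq y₁.pt
  set j : H.left.affineCover.X i ⟶ H.left := H.left.affineCover.f i with hj
  let V' : Motives.SchemeOver ℂ := Over.mk (j ≫ H.hom)
  let ι' : V' ⟶ H := Over.homMk j rfl
  have hι' : ι'.left = j := rfl
  haveI : IsAffine V'.left := inferInstanceAs (IsAffine (H.left.affineCover.X i))
  haveI : IsOpenImmersion ι'.left := inferInstanceAs (IsOpenImmersion j)
  haveI : LocallyOfFiniteType V'.hom := inferInstanceAs (LocallyOfFiniteType (j ≫ H.hom))
  haveI : LocallyOfFiniteType ι'.left := inferInstanceAs (LocallyOfFiniteType j)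
  -- lift `y₁` to `V'`
  obtain ⟨y₁', hy₁', -⟩ := exists_complexPoint_comp_eq_of_pt_mem ι' y₁ isClosed_univ
    (Set.mem_univ v) hv
  have hy₁'map : AlgPoints.map ι' y₁' = y₁ := hy₁'
  -- the closed irreducible `Y' = V ∩ Y` of `V'` and a second complex point over `U ∩ Y`
  set Y' : Set V'.left := j.base ⁻¹' Y with hY'def
  set U' : Set V'.left := j.base ⁻¹' U with hU'def
  have hY'c : IsClosed Y' := hYc.preimage j.continuous
  have hU'o : IsOpen U' := hUo.preimage j.continuous
  have hvY' : v ∈ Y' := by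
    change j.base v ∈ Y
    rw [hv]
    exact hy₁
  have hY' : IsIrreducible Y' := ⟨⟨v, hvY'⟩, hY.isPreirreducible.preimage j.isOpenEmbedding⟩
  have hUY' : (U' ∩ Y').Nonempty := by
    -- `Y` irreducible meets the opens `range j` (at `pt y₁`) and `U`, hence `range j ∩ U`
    have h1 : (Y ∩ Set.range j.base).Nonempty := ⟨y₁.pt, hy₁, v, hv⟩
    have h2 : (Y ∩ U).Nonempty := by
      obtain ⟨q, hqU, hqY⟩ := hUY
      exact ⟨q, hqY, hqU⟩
    obtain ⟨q, hqY, ⟨w, rfl⟩, hqU⟩ :=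
      hY.isPreirreducible _ _ j.isOpenEmbedding.isOpen_range hUo h1 h2
    exact ⟨w, hqU, hqY⟩
  obtain ⟨y₂', hy₂'⟩ := exists_complexPoint_pt_mem_inter hU'o hY'c hUY'
  have hne : y₁' ≠ y₂' := by
    intro he
    apply hy₁U
    have h1 : y₁.pt = j.base y₁'.pt := by
      rw [← hy₁'map, AlgPoints.pt_map]
      rfl
    rw [h1, he]
    exact hy₂'.1
  have hy₁'Y : y₁'.pt ∈ Y' := by
    change j.base y₁'.pt ∈ Y
    have h1 : j.base y₁'.pt = y₁.pt := by
      rw [← hy₁'map, AlgPoints.pt_map]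
      rfl
    rw [h1]
    exact hy₁
  -- Mumford's lemma: a smooth integral affine curve in `Y'` through `y₁'`, `y₂'`
  obtain ⟨C, g, a', b', hCaff, hCirr, hCsm, hCdim, hgY, ha', hb'⟩ :=
    hM ‹_› ‹_› Y' hY'c hY' y₁' y₂' hy₁'Y hy₂'.2 hne
  haveI := hCaff
  haveI := hCirr
  haveI := hCsm
  obtain ⟨hCint, hCrel⟩ := isIntegral_and_smoothOfRelativeDimension_one C hCdim
  haveI := hCint
  haveI := hCrel
  -- the family pulled back to `𝒳 × C`, good over the non-empty open `g⁻¹ U'`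
  set c : C ⟶ S := (g ≫ ι') ≫ h with hc
  set 𝒵₀ : Set (𝒳 ⊗ C).left := (𝒳 ◁ (g ≫ ι')).left.base ⁻¹' 𝒵 with h𝒵₀def
  have h𝒵₀ : IsClosed 𝒵₀ := h𝒵.preimage (𝒳 ◁ (g ≫ ι')).left.continuous
  set U₀ : Set C.left := (g ≫ ι').left.base ⁻¹' U with hU₀def
  have hU₀o : IsOpen U₀ := hUo.preimage (g ≫ ι').left.continuous
  have hpt : ∀ y : Motives.ComplexPoints C,
      (AlgPoints.map (g ≫ ι') y).pt = (g ≫ ι').left.base y.pt := fun y => AlgPoints.pt_map _ _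
  have hmemY : ∀ y : Motives.ComplexPoints C, (AlgPoints.map (g ≫ ι') y).pt ∈ Y := by
    intro y
    rw [hpt]
    exact hgY (y.pt)
  have hU₀ : U₀.Nonempty := by
    refine ⟨b'.pt, ?_⟩
    change (g ≫ ι').left.base b'.pt ∈ U
    rw [← hpt, AlgPoints.map_comp_apply, hb']
    exact hy₂'.1
  have key := mem_algebraicClasses_of_curve f hfam hS hSsm c p A h𝒵₀ hU₀o hU₀
    (fun y hy x hx => by
      rw [h𝒵₀def, Set.mem_preimage, whiskerLeft_sliceAt_base_apply] at hx
      exact hcodim (AlgPoints.map (g ≫ ι') y) ⟨(hpt y).symm ▸ hy, hmemY y⟩ x hx)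
    (fun y hy => by
      have e : AlgPoints.map c y = AlgPoints.map h (AlgPoints.map (g ≫ ι') y) :=
        AlgPoints.map_comp_apply _ _ _
      rw [e]
      have hset : (lift (Motives.fiberι f (AlgPoints.map h (AlgPoints.map (g ≫ ι') y)))
            (Motives.fiberOverToSpec f (AlgPoints.map h (AlgPoints.map (g ≫ ι') y)) ≫ y)).left.base
              ⁻¹' 𝒵₀ =
          (lift (Motives.fiberι f (AlgPoints.map h (AlgPoints.map (g ≫ ι') y)))
            (Motives.fiberOverToSpec f (AlgPoints.map h (AlgPoints.map (g ≫ ι') y)) ≫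
              AlgPoints.map (g ≫ ι') y)).left.base ⁻¹' 𝒵 := by
        ext z
        simp only [Set.mem_preimage]
        rw [lift_fiberι_base_apply, lift_fiberι_base_apply, h𝒵₀def, Set.mem_preimage,
          whiskerLeft_sliceAt_base_apply]
      rw [hset]
      exact hgood (AlgPoints.map (g ≫ ι') y) ⟨(hpt y).symm ▸ hy, hmemY y⟩)
    a'
  have e : AlgPoints.map c a' = AlgPoints.map h y₁ := by
    rw [hc, AlgPoints.map_comp_apply, AlgPoints.map_comp_apply, ha', hy₁'map]
  rw [e] at key
  exact key

end HodgeTheory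

end Literature.AlgebraicGeometry.HodgeTheory

end
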